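import Summits.MatrixMultiplication.OmegaCensus.SmallFormats.GF2Rank233Os
import Summits.MatrixMultiplication.OmegaCensus.SmallFormats.GF2TreeSplit
import HarnessLib

/-!
# ω-census family (a): kernel certificate `15 ≤ R_𝔽₂(⟨2,3,3⟩)` (ROOT CHECKS part 2: orbit 28, roots [1, 2, 7])

Cell `pub-omega` (unit `pub-omega-lit`, gen 4–5), topic `Summits/MatrixMultiplication/OmegaCensus` (sub-folder
`SmallFormats`). Framing (verbatim): lottery ticket; floor = certified bounds/negative ranges. HONEST FRAMING: a
kernel-checked replay of an INDEPENDENTLY REGENERATED Wang-2026-style certificate (orbit dynamic programme over the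
constraint subspaces of the first factor, techniques flatten / lookup / forced product / substitution-with-backtracking
DFS; generator `pub-omega-lit` gen 3–4 `gf2cert_v3.py`, kit job `j105706`, 31 orbits, 50605 DFS leaves; the DFS trees
are the landed DATA parts 1–9); the checker and its soundness are `GF2OrbitSweep.lean` / `GF2OrbitSplit.lean` and the
files they import. The number reproduces the published value (Hopcroft–Kerr 1971; Wang 2026, Table 3) — a FLOOR for
the census, not progress on `ω`. This file: the replay theorems for the DFS roots [1, 2, 7] of orbit 28 (7161 leaves); subtrees above 1600 leaves are split over their children (`BCert.check_of_kid`, `GF2TreeSplit.lean`) so that no single `decide +kernel` exceeds 1600 leaves; `st28_1_root_k : rootCheckB os st28_1 k = true` via `rootCheckB_eq`.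
-/

namespace Summit.MatrixMultiplication.OmegaCensus.GF2RankLB.Cert233

open Summit.MatrixMultiplication.OmegaCensus.GF2RankLB Literature.Computability.AlgebraicComplexity

/-- DFS root `1` of `st28_1` (1534 leaves) passes the replay check. -/
theorem st28_1_root_1 : rootCheckB os st28_1 1 = true := by decide +kernel

/-- DFS root `2` of `st28_1` (1532 leaves) passes the replay check. -/
theorem st28_1_root_2 : rootCheckB os st28_1 2 = true := by decide +kernel

/-- Subtree `[7, 9]` of `st28_1` (1446 leaves) passes the replay check. -/
theorem t28_1_7_9 :
    (kidOf (r28_1 (⟨7, by decide⟩ : Fin 31)) (⟨9, by decide⟩ : Fin 31)).check (lbOf os (tabOf st28_1)) 14 13 2 (Fin.snoc (fun _ => (⟨7, by decide⟩ : Fin 31)) (⟨9, by decide⟩ : Fin 31)) = true := by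
  decide +kernel

/-- Subtree `[7, 10]` of `st28_1` (284 leaves) passes the replay check. -/
theorem t28_1_7_10 :
    (kidOf (r28_1 (⟨7, by decide⟩ : Fin 31)) (⟨10, by decide⟩ : Fin 31)).check (lbOf os (tabOf st28_1)) 14 13 2 (Fin.snoc (fun _ => (⟨7, by decide⟩ : Fin 31)) (⟨10, by decide⟩ : Fin 31)) = true := by
  decide +kernel

/-- Subtree `[7, 11]` of `st28_1` (501 leaves) passes the replay check. -/
theorem t28_1_7_11 :
    (kidOf (r28_1 (⟨7, by decide⟩ : Fin 31)) (⟨11, by decide⟩ : Fin 31)).check (lbOf os (tabOf st28_1)) 14 13 2 (Fin.snoc (fun _ => (⟨7, by decide⟩ : Fin 31)) (⟨11, by decide⟩ : Fin 31)) = true := by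
  decide +kernel

/-- Subtree `[7, 13]` of `st28_1` (931 leaves) passes the replay check. -/
theorem t28_1_7_13 :
    (kidOf (r28_1 (⟨7, by decide⟩ : Fin 31)) (⟨13, by decide⟩ : Fin 31)).check (lbOf os (tabOf st28_1)) 14 13 2 (Fin.snoc (fun _ => (⟨7, by decide⟩ : Fin 31)) (⟨13, by decide⟩ : Fin 31)) = true := by
  decide +kernel

/-- Subtree `[7, 14]` of `st28_1` (184 leaves) passes the replay check. -/
theorem t28_1_7_14 :
    (kidOf (r28_1 (⟨7, by decide⟩ : Fin 31)) (⟨14, by decide⟩ : Fin 31)).check (lbOf os (tabOf st28_1)) 14 13 2 (Fin.snoc (fun _ => (⟨7, by decide⟩ : Fin 31)) (⟨14, by decide⟩ : Fin 31)) = true := by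
  decide +kernel

/-- Subtree `[7, 15]` of `st28_1` (249 leaves) passes the replay check. -/
theorem t28_1_7_15 :
    (kidOf (r28_1 (⟨7, by decide⟩ : Fin 31)) (⟨15, by decide⟩ : Fin 31)).check (lbOf os (tabOf st28_1)) 14 13 2 (Fin.snoc (fun _ => (⟨7, by decide⟩ : Fin 31)) (⟨15, by decide⟩ : Fin 31)) = true := by
  decide +kernel

/-- Subtree `[7, 17]` of `st28_1` (147 leaves) passes the replay check. -/
theorem t28_1_7_17 :
    (kidOf (r28_1 (⟨7, by decide⟩ : Fin 31)) (⟨17, by decide⟩ : Fin 31)).check (lbOf os (tabOf st28_1)) 14 13 2 (Fin.snoc (fun _ => (⟨7, by decide⟩ : Fin 31)) (⟨17, by decide⟩ : Fin 31)) = true := by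
  decide +kernel

/-- Subtree `[7, 18]` of `st28_1` (86 leaves) passes the replay check. -/
theorem t28_1_7_18 :
    (kidOf (r28_1 (⟨7, by decide⟩ : Fin 31)) (⟨18, by decide⟩ : Fin 31)).check (lbOf os (tabOf st28_1)) 14 13 2 (Fin.snoc (fun _ => (⟨7, by decide⟩ : Fin 31)) (⟨18, by decide⟩ : Fin 31)) = true := by
  decide +kernel

/-- Subtree `[7, 21]` of `st28_1` (104 leaves) passes the replay check. -/
theorem t28_1_7_21 :
    (kidOf (r28_1 (⟨7, by decide⟩ : Fin 31)) (⟨21, by decide⟩ : Fin 31)).check (lbOf os (tabOf st28_1)) 14 13 2 (Fin.snoc (fun _ => (⟨7, by decide⟩ : Fin 31)) (⟨21, by decide⟩ : Fin 31)) = true := by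
  decide +kernel

/-- Subtree `[7]` of `st28_1` (4095 leaves) passes the replay check. -/
theorem t28_1_7 :
    (r28_1 (⟨7, by decide⟩ : Fin 31)).check (lbOf os (tabOf st28_1)) 14 13 1 (fun _ => (⟨7, by decide⟩ : Fin 31)) = true :=
  check_of_kidOf _ _ (by decide +kernel) (by decide) fun mm => by
    fin_cases mm
    · intro hmm; exact absurd (hmm (Fin.last _)) (by decide)
    · intro hmm; exact absurd (hmm (Fin.last _)) (by decide)
    · intro hmm; exact absurd (hmm (Fin.last _)) (by decide)
    · intro hmm; exact absurd (hmm (Fin.last _)) (by decide)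
    · intro hmm; exact absurd (hmm (Fin.last _)) (by decide)
    · intro hmm; exact absurd (hmm (Fin.last _)) (by decide)
    · intro hmm; exact absurd (hmm (Fin.last _)) (by decide)
    · intro _; decide +kernel
    · intro _; decide +kernel
    · intro _; exact t28_1_7_9
    · intro _; exact t28_1_7_10
    · intro _; exact t28_1_7_11
    · intro _; decide +kernel
    · intro _; exact t28_1_7_13
    · intro _; exact t28_1_7_14
    · intro _; exact t28_1_7_15
    · intro _; decide +kernel
    · intro _; exact t28_1_7_17
    · intro _; exact t28_1_7_18
    · intro _; decide +kernel
    · intro _; decide +kernel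
    · intro _; exact t28_1_7_21
    · intro _; decide +kernel
    · intro _; decide +kernel
    · intro _; decide +kernel
    · intro _; decide +kernel
    · intro _; decide +kernel
    · intro _; decide +kernel
    · intro _; decide +kernel
    · intro _; decide +kernel
    · intro _; decide +kernel

/-- DFS root `7` of `st28_1` (4095 leaves) passes the replay check (`rootCheckB`). -/
theorem st28_1_root_7 : rootCheckB os st28_1 7 = true := by
  rw [rootCheckB_eq os st28_1 7 (by decide)]
  exact t28_1_7

end Summit.MatrixMultiplication.OmegaCensus.GF2RankLB.Cert233
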